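import Literature.AlgebraicGeometry.Resolution.QuadraticTransformsFactorization
import HarnessLib

/-!
# Along a chain of subrings exhausting a field up to inversion, every finitely generated ideal becomes
# principal — the termination engine of principalization / elimination of indeterminacies (Zariski)

Topic: `Literature/AlgebraicGeometry/Resolution`. PROVED, fact-free, definition-free (hand
leafhand-res-homologicalconduct-16 g2 of the cell decomp-res; AI-written, weaker than expert review).

THE MATHEMATICS (folklore; the last step of Zariski's proof of the finiteness of the sequence of quadratic
transformations, Lipman 1969 Theorem (26.2), p. 274, «(i) implies that the valuation ring `R_v` must be equal to
`⋃ R_i`»; Abhyankar 1956, Lemma 12; Huneke–Swanson Thm. 14.5.2). Let `R 0 ≤ R 1 ≤ ⋯` be a chain of subrings of a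
field `K` such that every `z ∈ K` has `z ∈ R n` or `z⁻¹ ∈ R n` for some `n` (i.e. `⋃ R n` is a valuation ring of
`K`), and let `T ⊆ R 0` be a finite set containing a non-zero element. Then for some `n` and some non-zero `a ∈ T`
every `t ∈ T` is a multiple of `a` in `R n`: the ideal `T · R n` is PRINCIPAL, generated by one of the given
generators. Proof: divisibility in `⋃ R n` is a total preorder on the non-zero elements of `T` (that is the
hypothesis), so the finite set has a minimal element `a`; each `t / a` lies in some `R n`, and finitely many
indices have a common bound.

* (private plumbing) `exists_forall_eventually_of_finset` — finitely many eventually-true monotone properties hold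
  simultaneously from some index on;
* `exists_minimal_generator_of_chain` — the minimal element: `∀ t ∈ T, ∃ n, t * a⁻¹ ∈ R n`;
* `exists_principal_generator_of_chain` — **the engine**: `∃ n, ∃ a ∈ T, a ≠ 0 ∧ ∀ t ∈ T, ∃ r ∈ R n, t = a * r`;
* `exists_principal_generator_of_quadraticSequence` — fed with the tree's Huneke–Swanson termination
  `exists_mem_or_inv_mem_of_sequence`: along an infinite sequence of quadratic transforms of `R 0` (`K = Frac (R 0)`)
  inside a Noetherian local ring `S` dominating every `R n`, every finite `T ⊆ R 0` with a non-zero element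
  generates a principal ideal `a · R n` (`a ∈ T`) for `n ≫ 0`.

Use (route to Lipman's statement B) / Zariski's Theorem (26.1) for regular surfaces, tree
`Lipman1969_1_2_B_of_principalization`): an infinite tower of blowing ups of «bad» closed points of an ideal sheaf
`K` on a regular surface yields, by König's lemma, an infinite sequence of quadratic transforms at bad points; once
its union is known to be a valuation ring (Abhyankar 1956, Lemma 12 — NOT here), this file makes `K` principal at
some stage, contradicting badness.  Nothing else is claimed; no summit statement is proved.

## References
* J. Lipman, Publ. Math. IHÉS 36 (1969), Theorem (26.2) and its proof (p. 274). [Lipman1969]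
* S. S. Abhyankar, *On the valuations centered in a local domain*, Amer. J. Math. 78 (1956), Lemma 12.
  [Abhyankar1956Valuations]
* C. Huneke, I. Swanson, *Integral Closure of Ideals, Rings, and Modules*, CUP 2006, Thm. 14.5.2 (proof).
  [HunekeSwanson2006]
-/

noncomputable section

namespace Literature.AlgebraicGeometry.Resolution

universe u v

open IsLocalRing

/-- **Finitely many eventually-true monotone properties hold simultaneously from some index on.**
[folklore] -/
private theorem exists_forall_eventually_of_finset {α : Type v} (T : Finset α) (P : ℕ → α → Prop)
    (hmono : ∀ m n a, m ≤ n → P m a → P n a) (h : ∀ a ∈ T, ∃ n, P n a) :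
    ∃ N, ∀ a ∈ T, P N a := by
  classical
  induction T using Finset.induction_on with
  | empty => exact ⟨0, fun a ha => absurd ha (Finset.notMem_empty a)⟩
  | insert b T hb ih =>
    obtain ⟨N₁, hN₁⟩ := ih fun a ha => h a (Finset.mem_insert_of_mem ha)
    obtain ⟨n, hn⟩ := h b (Finset.mem_insert_self b T)
    refine ⟨max N₁ n, fun a ha => ?_⟩
    rcases Finset.mem_insert.mp ha with rfl | ha
    · exact hmono _ _ _ (le_max_right _ _) hn
    · exact hmono _ _ _ (le_max_left _ _) (hN₁ a ha)

variable {K : Type u} [Field K]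

/-- **A minimal generator.** For a chain `R 0 ≤ R 1 ≤ ⋯` of subrings of `K` with `z ∈ R n` or `z⁻¹ ∈ R n`
(some `n`) for every `z`, every finite non-empty set `T` of NON-ZERO elements of `K` has an element `a` dividing
all the others in `⋃ R n`: `∀ t ∈ T, ∃ n, t * a⁻¹ ∈ R n`.  (Divisibility in `⋃ R n` is a total preorder.)
[cite: Lipman1969, Theorem (26.2), proof (p. 274)] -/
theorem exists_minimal_generator_of_chain (R : ℕ → Subring K) (hmono : ∀ n, R n ≤ R (n + 1))
    (hval : ∀ z : K, (∃ n, z ∈ R n) ∨ (∃ n, z⁻¹ ∈ R n))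
    (T : Finset K) (hT : T.Nonempty) (hT0 : ∀ t ∈ T, t ≠ 0) :
    ∃ a ∈ T, ∀ t ∈ T, ∃ n, t * a⁻¹ ∈ R n := by
  classical
  have hRmono : Monotone R := monotone_nat_of_le_succ hmono
  induction hT using Finset.Nonempty.cons_induction with
  | singleton b =>
    refine ⟨b, Finset.mem_singleton_self b, fun t ht => ⟨0, ?_⟩⟩
    rw [Finset.mem_singleton] at ht
    subst ht
    rw [mul_inv_cancel₀ (hT0 t (Finset.mem_singleton_self t))]
    exact (R 0).one_mem
  | cons b T hb hTne ih =>
    obtain ⟨a, haT, ha⟩ := ih fun t ht => hT0 t (Finset.mem_cons_of_mem ht)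
    have ha0 : a ≠ 0 := hT0 a (Finset.mem_cons_of_mem haT)
    have hb0 : b ≠ 0 := hT0 b (Finset.mem_cons_self b T)
    rcases hval (b * a⁻¹) with ⟨n, hn⟩ | ⟨n, hn⟩
    · -- `a` still divides everything
      refine ⟨a, Finset.mem_cons_of_mem haT, fun t ht => ?_⟩
      rcases Finset.mem_cons.mp ht with rfl | ht
      · exact ⟨n, hn⟩
      · exact ha t ht
    · -- `b` divides `a`, hence everything
      rw [mul_inv_rev, inv_inv] at hn
      refine ⟨b, Finset.mem_cons_self b T, fun t ht => ?_⟩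
      rcases Finset.mem_cons.mp ht with rfl | ht
      · refine ⟨0, ?_⟩
        rw [mul_inv_cancel₀ hb0]
        exact (R 0).one_mem
      · obtain ⟨m, hm⟩ := ha t ht
        refine ⟨max m n, ?_⟩
        have hmul : t * b⁻¹ = (t * a⁻¹) * (a * b⁻¹) := by
          rw [mul_assoc, ← mul_assoc a⁻¹, inv_mul_cancel₀ ha0, one_mul]
        rw [hmul]
        exact (R (max m n)).mul_mem (hRmono (le_max_left m n) hm) (hRmono (le_max_right m n) hn)

/-- **The engine: along a chain of subrings of `K` exhausting `K` up to inversion, every finite set of elements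
of `R 0` with a non-zero member generates, in some `R n`, the PRINCIPAL ideal of one of its members.**
For `R 0 ≤ R 1 ≤ ⋯ ≤ K` with `∀ z, (∃ n, z ∈ R n) ∨ (∃ n, z⁻¹ ∈ R n)` and `T ⊆ R 0` finite containing some
`t ≠ 0`: `∃ n, ∃ a ∈ T, a ≠ 0 ∧ ∀ t ∈ T, ∃ r ∈ R n, t = a * r` (Zariski's termination: an ideal finitely
generated at the bottom of an infinite quadratic sequence whose union is a valuation ring is principal at some
stage). [cite: Lipman1969, Theorem (26.2), proof (p. 274)] [cite: Abhyankar1956Valuations, Lemma 12] -/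
theorem exists_principal_generator_of_chain (R : ℕ → Subring K) (hmono : ∀ n, R n ≤ R (n + 1))
    (hval : ∀ z : K, (∃ n, z ∈ R n) ∨ (∃ n, z⁻¹ ∈ R n))
    (T : Finset K) (hne : ∃ t ∈ T, t ≠ 0) :
    ∃ n, ∃ a ∈ T, a ≠ 0 ∧ ∀ t ∈ T, ∃ r ∈ R n, t = a * r := by
  classical
  have hRmono : Monotone R := monotone_nat_of_le_succ hmono
  -- the non-zero part of `T`
  set T' : Finset K := T.filter (· ≠ 0) with hT'
  have hT'ne : T'.Nonempty := by
    obtain ⟨t, ht, ht0⟩ := hne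
    exact ⟨t, Finset.mem_filter.mpr ⟨ht, ht0⟩⟩
  have hT'0 : ∀ t ∈ T', t ≠ 0 := fun t ht => (Finset.mem_filter.mp ht).2
  obtain ⟨a, haT', ha⟩ := exists_minimal_generator_of_chain R hmono hval T' hT'ne hT'0
  have ha0 : a ≠ 0 := hT'0 a haT'
  -- a common index for the finitely many quotients `t / a`
  obtain ⟨N, hN⟩ := exists_forall_eventually_of_finset T' (fun n t => t * a⁻¹ ∈ R n)
    (fun m n t hmn h => hRmono hmn h) ha
  refine ⟨N, a, (Finset.mem_filter.mp haT').1, ha0, fun t ht => ?_⟩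
  by_cases ht0 : t = 0
  · exact ⟨0, (R N).zero_mem, by rw [ht0, mul_zero]⟩
  · refine ⟨t * a⁻¹, hN t (Finset.mem_filter.mpr ⟨ht, ht0⟩), ?_⟩
    rw [mul_comm a, mul_assoc, inv_mul_cancel₀ ha0, mul_one]

/-- **Along an infinite sequence of quadratic transforms inside a Noetherian local ring, finitely generated ideals
become principal.**  `R 0 → R 1 → ⋯` quadratic transforms with `K = Frac (R 0)`, all dominated by a Noetherian local
subring `S ≤ K`; `T ⊆ R 0` finite with a non-zero member.  Then `T · R n = a · R n` for some `n` and some non-zero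
`a ∈ T` — the tree's Huneke–Swanson termination `exists_mem_or_inv_mem_of_sequence` (every `z` has `z` or `z⁻¹`
in some `R n`) fed into `exists_principal_generator_of_chain`.
[cite: HunekeSwanson2006, Thm. 14.5.2 (proof)] [cite: Lipman1969, Theorem (26.2), proof (p. 274)] -/
theorem exists_principal_generator_of_quadraticSequence {S : Subring K} [IsLocalRing S] [IsNoetherianRing S]
    (R : ℕ → Subring K) (hof : IsLocalRingOf (R 0))
    (hdom : ∀ n, SubringDominates (R n) S) (hqt : ∀ n, IsQuadraticTransform (R n) (R (n + 1)))
    (T : Finset K) (hT : ∀ t ∈ T, t ∈ R 0) (hne : ∃ t ∈ T, t ≠ 0) :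
    ∃ n, ∃ a ∈ T, a ≠ 0 ∧ (∀ t ∈ T, t ∈ R n) ∧ ∀ t ∈ T, ∃ r ∈ R n, t = a * r := by
  have hmono : ∀ n, R n ≤ R (n + 1) := fun n => (hqt n).dominates.1
  have hRmono : Monotone R := monotone_nat_of_le_succ hmono
  obtain ⟨n, a, haT, ha0, h⟩ := exists_principal_generator_of_chain R hmono
    (exists_mem_or_inv_mem_of_sequence R hof hdom hqt) T hne
  exact ⟨n, a, haT, ha0, fun t ht => hRmono (Nat.zero_le n) (hT t ht), h⟩

end Literature.AlgebraicGeometry.Resolution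

end
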